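import Summits.FinalStateConjecture.FinalStateConjecture.Theorems.ClusterCompletenessAdiabaticMultiKerrILEDMorawetzWeightedGraph

/-!
# Route ClusterCompleteness — crux `AdiabaticMultiKerrILED`, line `Sketch`:
# the generic integrated weighted current inequality between tilted leaves (static tails-cut zone)

Helper file for the crux `stmt-FinalStateConjecture-14310`
(`Summit.FinalStateConjecture.FinalStateConjecture.Theses.ClusterCompleteness.AdiabaticMultiKerrILED`),
line `Sketch`, stub `tailsCut_weighted_graph_le` (lead c7, wave 7).

Setting (one zone, zero spin, rest frame): an arbitrary current `J` on `ℝ⁴`, the STATIC cut-off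
`Wt = χ(u₂/ε − 1) · χ(2 − ‖x⃗‖²/R²)` (`χ = Real.smoothTransition`, `u₂ = Kerr.horizonFn M 0`,
`r = Kerr.radius 0`), a "good bulk" `b` continuous at the points with `r > 2M` and a continuous
error `e ≥ 0` vanishing where `u₂ < ε` or `‖x⃗‖² > 2R²`. The lab slices are the tilted leaves
`{x⁰ = t + F(x⃗)}` of a `C²` height `F`, with conormal `n = Kerr.graphConormal F`.

* `tailsCut_weighted_graph_le` — **the registered stub**: if `Wt J ∈ C¹(ℝ⁴)` and
  `Wt b − e ≤ ∑_μ ∂_μ(Wt J^μ)` at the slab points `{F(x⃗) ≤ x⁰ ≤ s + F(x⃗)}` with `r > 2M`, then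
  `∫_{u ∈ (0,s]} ∫ Wt b ≤ (weighted flux through {x⁰ = F}) − (weighted flux through {x⁰ = s + F})
  + ∫_{u ∈ (0,s]} ∫ e`. It is the specialisation of the abstract step
  `weightedGraphFlux_integral_le_of_bulk` to the closed support set
  `K = {ε ≤ u₂} ∩ {‖x⃗‖² ≤ 2R²}` (off `K` a factor of `Wt` vanishes; on `K`, `r > r₊ = 2M` and
  `‖x⃗‖ ≤ 2R`), with `ℓ = Wt b` (continuous on `ℝ⁴`: a product of functions continuous at the
  points `r > 2M`, identically zero on the open neighbourhood `{u₂ < ε}` of `{r ≤ 2M}`).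

Dafermos–Rodnianski–Shlapentokh-Rothman arXiv:1402.7034, §2.3.2 (the energy identity of a current
between leaves, (ingeneralform2)). [folklore]
-/

noncomputable section

-- the doubled `FinalStateConjecture.FinalStateConjecture` path component trips dupNamespace
set_option linter.dupNamespace false

open Set Filter Metric MeasureTheory
open scoped BigOperators Topology
open Literature.Geometry.Lorentzian

namespace Summit.FinalStateConjecture.FinalStateConjecture.Theorems

/-! ### The static tails-cut weight -/

/-- **The static weight vanishes near the horizon layer**: where `u₂ < ε` the horizon factor
`χ(u₂/ε − 1)` of `Wt` vanishes (`ε > 0`). [folklore] -/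
theorem tailsCutWeight_eq_zero_of_horizonFn_lt {M ε R : ℝ} (hε : 0 < ε) {x : E4}
    (hx : Kerr.horizonFn M 0 x < ε) :
    Real.smoothTransition (Kerr.horizonFn M 0 x / ε - 1) *
      Real.smoothTransition (2 - E4.spatialNorm x ^ 2 / R ^ 2) = 0 := by
  have h : Kerr.horizonFn M 0 x / ε - 1 ≤ 0 := by
    rw [sub_nonpos, div_le_one hε]
    exact hx.le
  rw [Real.smoothTransition.zero_of_nonpos h, zero_mul]

/-- **The static weight vanishes far out**: where `‖x⃗‖² > 2R²` the spatial factor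
`χ(2 − ‖x⃗‖²/R²)` of `Wt` vanishes (`R > 0`). [folklore] -/
theorem tailsCutWeight_eq_zero_of_lt_spatialNorm_sq {M ε R : ℝ} (hR : 0 < R) {x : E4}
    (hx : 2 * R ^ 2 < E4.spatialNorm x ^ 2) :
    Real.smoothTransition (Kerr.horizonFn M 0 x / ε - 1) *
      Real.smoothTransition (2 - E4.spatialNorm x ^ 2 / R ^ 2) = 0 := by
  have h : 2 - E4.spatialNorm x ^ 2 / R ^ 2 ≤ 0 := by
    rw [sub_nonpos, le_div_iff₀ (by positivity : (0 : ℝ) < R ^ 2)]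
    exact hx.le
  rw [Real.smoothTransition.zero_of_nonpos h, mul_zero]

/-- **The static weight is continuous on `ℝ⁴`** (`M > 0`, `ε > 0`): the horizon factor is smooth
(`Kerr.contDiff_horizonFactor`) and the spatial factor is a smooth function of `‖x⃗‖²`.
[folklore] -/
theorem continuous_tailsCutWeight {M ε : ℝ} (R : ℝ) (hM : 0 < M) (hε : 0 < ε) :
    Continuous fun x : E4 ↦ Real.smoothTransition (Kerr.horizonFn M 0 x / ε - 1) *
      Real.smoothTransition (2 - E4.spatialNorm x ^ 2 / R ^ 2) := by
  have hrp : 0 < Kerr.rPlus M 0 := by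
    rw [Kerr.rPlus_zero_right hM.le]
    positivity
  exact (Kerr.contDiff_horizonFactor (a := 0) (n := 0) hrp hε).continuous.mul
    (Real.smoothTransition.continuous.comp
      (continuous_const.sub ((Kerr.contDiff_spatialNorm_sq (n := 0)).continuous.div_const _)))

/-- **The weighted bulk `Wt b` is continuous on `ℝ⁴`** when `b` is continuous at every point with
`r > 2M` (`M > 0`, `ε > 0`): at such points it is a product of continuous functions, and a point
with `r ≤ 2M` has `u₂ ≤ 0 < ε`, so `Wt` vanishes identically on the open neighbourhood `{u₂ < ε}`
of it (`Kerr.continuous_horizonFn`). [folklore] -/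
theorem continuous_tailsCutWeight_mul {M ε : ℝ} (R : ℝ) (hM : 0 < M) (hε : 0 < ε) {b : E4 → ℝ}
    (hb : ∀ x : E4, 2 * M < Kerr.radius 0 x → ContinuousAt b x) :
    Continuous fun x : E4 ↦ Real.smoothTransition (Kerr.horizonFn M 0 x / ε - 1) *
      Real.smoothTransition (2 - E4.spatialNorm x ^ 2 / R ^ 2) * b x := by
  rw [continuous_iff_continuousAt]
  intro x
  rcases lt_or_ge (2 * M) (Kerr.radius 0 x) with hx | hx
  · exact (continuous_tailsCutWeight R hM hε).continuousAt.mul (hb x hx)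
  · have h0 : Kerr.horizonFn M 0 x < ε := by
      refine lt_of_le_of_lt ?_ hε
      unfold Kerr.horizonFn
      rw [Kerr.rPlus_zero_right hM.le]
      exact mul_nonpos_iff.mpr (Or.inr ⟨by linarith, (Real.exp_pos _).le⟩)
    have hev : ∀ᶠ y in 𝓝 x, Kerr.horizonFn M 0 y < ε :=
      (Kerr.continuous_horizonFn M 0).continuousAt.eventually_lt continuousAt_const h0
    refine Filter.EventuallyEq.continuousAt (y := (0 : ℝ)) ?_
    filter_upwards [hev] with y hy
    rw [tailsCutWeight_eq_zero_of_horizonFn_lt hε hy, zero_mul]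

/-! ### The registered stub -/

/-- **The generic integrated weighted current inequality between tilted leaves** (crux
`stmt-FinalStateConjecture-14310`, line `Sketch`, stub `tailsCut_weighted_graph_le`). For the static
weight `Wt = χ(u₂/ε − 1) χ(2 − ‖x⃗‖²/R²)` (`u₂ = Kerr.horizonFn M 0`, `M, ε, R > 0`), any current
`J` with `Wt J ∈ C¹(ℝ⁴)`, any `b` continuous at the points with `r > 2M` and any continuous
`e ≥ 0` vanishing where `u₂ < ε` or `‖x⃗‖² > 2R²`: if `Wt b − e ≤ ∑_μ ∂_μ(Wt J^μ)` at the points of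
the slab `{F(x⃗) ≤ x⁰ ≤ s + F(x⃗)}` with `r > 2M` (`F ∈ C²`, `0 ≤ s`), then `∫_{u ∈ (0,s]} ∫ Wt b`
over the leaves in between is at most the weighted flux `∫ Wt (−∑ J^μ n_μ)` through `{x⁰ = F}`
minus the one through `{x⁰ = s + F}` plus `∫_{u ∈ (0,s]} ∫ e` (`n = Kerr.graphConormal F`).
Proof: `weightedGraphFlux_integral_le_of_bulk` with the closed support set
`K = {ε ≤ u₂} ∩ {‖x⃗‖² ≤ 2R²}` (off `K` a factor of `Wt` vanishes; on `K`, `r > r₊ = 2M` by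
`Kerr.rPlus_lt_radius_of_horizonFn_pos` and `‖x⃗‖ ≤ 2R`), `ρ = 2R`, `P = (2M < r ·)` and
`ℓ = Wt b` (`continuous_tailsCutWeight_mul`). Dafermos–Rodnianski–Shlapentokh-Rothman
arXiv:1402.7034, §2.3.2 (ingeneralform2). [folklore] -/
theorem tailsCut_weighted_graph_le : ∀ (M ε R : ℝ) (F : E3 → ℝ) (J : E4 → Fin 4 → ℝ) (b e : E4 → ℝ) (s : ℝ), let Wt : E4 → ℝ := fun y ↦ (Real.smoothTransition (Kerr.horizonFn M 0 y / ε - 1) * Real.smoothTransition (2 - E4.spatialNorm y ^ 2 / R ^ 2)); 0 < M → 0 < ε → 0 < R → ContDiff ℝ 2 F → (∀ y, ‖fderiv ℝ F y‖ ≤ 2⁻¹) → 0 ≤ s → (∀ μ : Fin 4, ContDiff ℝ 1 (fun y ↦ Wt y * J y μ)) → (∀ x : E4, 2 * M < Kerr.radius 0 x → ContinuousAt b x) → Continuous e → (∀ x, 0 ≤ e x) → (∀ x : E4, (Kerr.horizonFn M 0 x < ε ∨ 2 * R ^ 2 < E4.spatialNorm x ^ 2) → e x = 0) → (∀ x : E4,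 F (E4.spatial x) ≤ x 0 → x 0 ≤ s + F (E4.spatial x) → 2 * M < Kerr.radius 0 x → Wt x * b x - e x ≤ ∑ μ, fderiv ℝ (fun y ↦ Wt y * J y μ) x (E4.basisVector μ)) → ∫ u in Set.Ioc 0 s, ∫ y : E3, Wt (E4.ofTimeSpace (u + F y) y) * b (E4.ofTimeSpace (u + F y) y) ≤ (∫ y : E3, Wt (E4.ofTimeSpace (0 + F y) y) * (-∑ μ, J (E4.ofTimeSpace (0 + F y) y) μ * Kerr.graphConormal F y μ)) - (∫ y : E3, Wt (E4.ofTimeSpace (s + F y) y) * (-∑ μ, J (E4.ofTimeSpace (s + F y) y) μ * Kerr.graphConormal F y μ)) + ∫ u in Set.Ioc 0 s, ∫ y : E3, e (E4.ofTimeSpace (u + F y) y) := by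
  intro M ε R F J b e s Wt hM hε hR hF _hslope hs hJ1 hb he_cont he0 heK hdiv
  -- the support set of the weight: closed
  set K : Set E4 := {x | ε ≤ Kerr.horizonFn M 0 x ∧ E4.spatialNorm x ^ 2 ≤ 2 * R ^ 2} with hK
  have hKc : IsClosed K := by
    rw [hK, Set.setOf_and]
    exact (isClosed_le continuous_const (Kerr.continuous_horizonFn M 0)).inter
      (isClosed_le (Kerr.contDiff_spatialNorm_sq (n := 0)).continuous continuous_const)
  -- the weight: explicit form and vanishing off `K`
  have hWt : ∀ x, Wt x = Real.smoothTransition (Kerr.horizonFn M 0 x / ε - 1) *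
      Real.smoothTransition (2 - E4.spatialNorm x ^ 2 / R ^ 2) := fun x ↦ rfl
  have hWK : ∀ x, x ∉ K → Wt x = 0 := by
    intro x hx
    by_contra hne
    refine hx ⟨?_, ?_⟩
    · by_contra hlt
      exact hne (tailsCutWeight_eq_zero_of_horizonFn_lt hε (not_le.mp hlt))
    · by_contra hlt
      exact hne (tailsCutWeight_eq_zero_of_lt_spatialNorm_sq hR (not_le.mp hlt))
  -- slab points of `K`: spatially bounded by `2R`, strictly exterior
  have hρ : ∀ x ∈ K, F (E4.spatial x) ≤ x 0 → x 0 ≤ s + F (E4.spatial x) →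
      E4.spatialNorm x ≤ 2 * R ∧ 2 * M < Kerr.radius 0 x := by
    intro x hx _ _
    refine ⟨?_, ?_⟩
    · have h2 : E4.spatialNorm x ^ 2 ≤ 2 * R ^ 2 := hx.2
      nlinarith [E4.spatialNorm_nonneg x, h2]
    · rw [← Kerr.rPlus_zero_right hM.le]
      exact Kerr.rPlus_lt_radius_of_horizonFn_pos (lt_of_lt_of_le hε hx.1)
  -- the error density vanishes off `K`
  have heK' : ∀ x, x ∉ K → e x = 0 := by
    intro x hx
    refine heK x ?_
    by_contra h
    rw [not_or, not_lt, not_lt] at h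
    exact hx h
  -- the bulk density `Wt b` is continuous on `ℝ⁴` and vanishes off `K`
  have hℓc : Continuous fun x ↦ Wt x * b x := continuous_tailsCutWeight_mul R hM hε hb
  have hℓK : ∀ x, x ∉ K → Wt x * b x = 0 := fun x hx ↦ by rw [hWK x hx, zero_mul]
  exact weightedGraphFlux_integral_le_of_bulk (K := K) (W := Wt) (J := J)
    (ℓ := fun x ↦ Wt x * b x) (e := e) (P := fun x ↦ 2 * M < Kerr.radius 0 x) (ρ := 2 * R)
    hKc hJ1 hWK hF hρ hℓc hℓK he_cont he0 heK' (fun x h1 h2 hP ↦ hdiv x h1 h2 hP) hs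

end Summit.FinalStateConjecture.FinalStateConjecture.Theorems
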